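import Literature.NumberTheory.Automorphic.UnitaryGroupAdelicCenter
import Literature.NumberTheory.Automorphic.RelNormOneTorus
import HarnessLib

/-!
# `U(1)(𝔸_F)` in the unitary-group currency **is** the relative-norm-one torus `ker N_{E/F}` on ideles

Junction of two tree currencies for the same group, the adelic points of the norm-one torus
`U(1)_{E/F} = ker (N_{E/F} : Res_{E/F} 𝔾_m → 𝔾_m)` of a quadratic extension `E/F` of number fields
with non-trivial automorphism `c`:

* `UnitaryGroup.adelicOne F E c = {u ∈ 𝔸_Eˣ | (c ⊗ 1)(u) · u = 1}` (`UnitaryGroupAdelicCenter`, the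
  source of the centre `u ↦ u · 1_N` of every `U(J)(𝔸_F)`), and
* `relNormOneIdeles F E = ker (y ↦ ∏_{σ ∈ Aut(E/F)} σ • y)` (`RelNormOneTorus`, the currency of the
  automorphic characters of `U(1)_{E/F}(𝔸_F) / U(1)(F)`).

For `[E : F] = 2` and `c ≠ 1`, `Aut(E/F) = {1, c}` and `N y = y · (c • y)`, so the two subgroups of
`𝔸_Eˣ` COINCIDE (`adelicOne_eq_relNormOneIdeles`); the CM case `E = L`, `F = L⁺`, `c` = complex
conjugation is `cm_adelicOne_eq_relNormOneIdeles`, with the induced `MulEquiv`. Rational points match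
too: `relNormOneRat` = the principal ideles inside the torus.

References: [PlatonovRapinchuk1994, §6.2] (the norm-one torus); [CasselsFrohlichANT1967, Ch. VII §1.1]
(Galois action on adeles); [Mok2014, §1 Notation p. 5] (`U(1)_{E/F}`). KERNEL ONLY: 0 records,
0 named facts, 0 sorry. Model-construction cell pub-hodgecm, node W2-Kn (the normalising character
`η` of the K-type-normalised splitting is a character of this torus composed with `det`).
-/

set_option autoImplicit false

noncomputable section

open NumberField

namespace Literature.NumberTheory.Automorphic

namespace UnitaryGroup

section Quadratic

variable (F E : Type) [Field F] [Field E] [NumberField E] [Algebra F E] (c : E ≃ₐ[F] E)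

/-- the idele-level Galois action, on underlying adeles: `↑(c • y) = (c ⊗ 1)(↑y)`. [folklore] -/
theorem val_smul_eq_conjAdele (y : (AdeleRing (𝓞 E) E)ˣ) :
    ((c • y : (AdeleRing (𝓞 E) E)ˣ) : AdeleRing (𝓞 E) E) = conjAdele F E c (y : AdeleRing (𝓞 E) E) :=
  rfl

variable [FiniteDimensional F E]

omit [NumberField E] in
/-- In an extension of degree `2` with a non-trivial automorphism `c`, every automorphism is `1` or
`c` (`#Aut(E/F) ≤ [E : F] = 2`). [folklore] -/
theorem algEquiv_eq_one_or_eq (h2 : Module.finrank F E = 2) (hc : c ≠ 1) (σ : E ≃ₐ[F] E) :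
    σ = 1 ∨ σ = c := by
  classical
  by_contra h
  obtain ⟨h₁, h₂⟩ := not_or.mp h
  have h3 : ({1, c, σ} : Finset (E ≃ₐ[F] E)).card = 3 := by
    rw [Finset.card_insert_of_notMem, Finset.card_insert_of_notMem, Finset.card_singleton]
    · simpa using fun h' => h₂ h'.symm
    · simp only [Finset.mem_insert, Finset.mem_singleton, not_or]
      exact ⟨fun h' => hc h'.symm, fun h' => h₁ h'.symm⟩
  have h4 := Finset.card_le_univ ({1, c, σ} : Finset (E ≃ₐ[F] E))
  rw [h3] at h4
  have h5 : Fintype.card (E ≃ₐ[F] E) ≤ 2 := h2 ▸ AlgEquiv.card_le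
  omega

/-- For quadratic `E/F` with non-trivial automorphism `c`: `N y = y · (c • y)` (`Aut(E/F) = {1, c}`).
[folklore] -/
theorem ideleGalNorm_eq_mul_smul (h2 : Module.finrank F E = 2) (hc : c ≠ 1) (y : (AdeleRing (𝓞 E) E)ˣ) :
    AdeleRing.ideleGalNorm F E y = y * c • y := by
  classical
  have huniv : (Finset.univ : Finset (E ≃ₐ[F] E)) = {1, c} := by
    ext σ
    simp only [Finset.mem_univ, Finset.mem_insert, Finset.mem_singleton, true_iff]
    exact algEquiv_eq_one_or_eq F E c h2 hc σ
  rw [AdeleRing.ideleGalNorm_apply, huniv, Finset.prod_pair (Ne.symm hc), one_smul]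

/-- **`U(1)(𝔸_F)` (unitary currency) `=` `ker N_{E/F}` (idele currency)** for `[E : F] = 2`, `c ≠ 1`.
[cite: PlatonovRapinchuk1994, §6.2] -/
theorem adelicOne_eq_relNormOneIdeles (h2 : Module.finrank F E = 2) (hc : c ≠ 1) :
    adelicOne F E c = relNormOneIdeles F E := by
  ext u
  rw [mem_adelicOne_iff, mem_relNormOneIdeles_iff, ideleGalNorm_eq_mul_smul F E c h2 hc, Units.ext_iff,
    Units.val_mul, val_smul_eq_conjAdele, Units.val_one, mul_comm]

/-- membership form of `adelicOne_eq_relNormOneIdeles`. [folklore] -/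
theorem mem_adelicOne_iff_mem_relNormOneIdeles (h2 : Module.finrank F E = 2) (hc : c ≠ 1)
    (u : (AdeleRing (𝓞 E) E)ˣ) : u ∈ adelicOne F E c ↔ u ∈ relNormOneIdeles F E := by
  rw [adelicOne_eq_relNormOneIdeles F E c h2 hc]

/-- the identification as a `MulEquiv` (it is the identity on underlying ideles). [folklore] -/
def adelicOneEquivRelNormOne (h2 : Module.finrank F E = 2) (hc : c ≠ 1) :
    adelicOne F E c ≃* relNormOneIdeles F E :=
  MulEquiv.subgroupCongr (adelicOne_eq_relNormOneIdeles F E c h2 hc)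

/-- underlying idele of the identification: unchanged. [folklore] -/
@[simp] theorem coe_adelicOneEquivRelNormOne (h2 : Module.finrank F E = 2) (hc : c ≠ 1) (u : adelicOne F E c) :
    ((adelicOneEquivRelNormOne F E c h2 hc u : relNormOneIdeles F E) : (AdeleRing (𝓞 E) E)ˣ) = u :=
  rfl

/-- **rational points match**: `u` is a principal idele iff its image lies in `relNormOneRat` (the
principal ideles inside the torus). [folklore] -/
theorem adelicOneEquivRelNormOne_mem_relNormOneRat_iff (h2 : Module.finrank F E = 2) (hc : c ≠ 1)
    (u : adelicOne F E c) :
    adelicOneEquivRelNormOne F E c h2 hc u ∈ relNormOneRat F E ↔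
      (u : (AdeleRing (𝓞 E) E)ˣ) ∈ GaloisRepresentations.principalIdeles E :=
  mem_relNormOneRat_iff F E _

end Quadratic

section CM

variable (L : Type) [Field L] [NumberField L] [IsCMField L]

/-- **the CM case**: `U(1)(𝔸_{L⁺})` for `L/L⁺` with complex conjugation `=` `ker N_{L/L⁺}` on `𝔸_Lˣ`.
[cite: PlatonovRapinchuk1994, §6.2] -/
theorem cm_adelicOne_eq_relNormOneIdeles :
    adelicOne (↥(maximalRealSubfield L)) L (IsCMField.complexConj L) =
      relNormOneIdeles (↥(maximalRealSubfield L)) L :=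
  adelicOne_eq_relNormOneIdeles _ L _ (Algebra.IsQuadraticExtension.finrank_eq_two _ L)
    (IsCMField.complexConj_ne_one (K := L))

/-- the CM identification as a `MulEquiv`. [folklore] -/
def cmAdelicOneEquivRelNormOne :
    adelicOne (↥(maximalRealSubfield L)) L (IsCMField.complexConj L) ≃* relNormOneIdeles (↥(maximalRealSubfield L)) L :=
  adelicOneEquivRelNormOne _ L _ (Algebra.IsQuadraticExtension.finrank_eq_two _ L)
    (IsCMField.complexConj_ne_one (K := L))

/-- underlying idele: unchanged. [folklore] -/
@[simp] theorem coe_cmAdelicOneEquivRelNormOne (u : adelicOne (↥(maximalRealSubfield L)) L (IsCMField.complexConj L)) :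
    ((cmAdelicOneEquivRelNormOne L u : relNormOneIdeles (↥(maximalRealSubfield L)) L) : (AdeleRing (𝓞 L) L)ˣ) = u :=
  rfl

end CM

end UnitaryGroup

end Literature.NumberTheory.Automorphic

end
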